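import Literature.Geometry.Symplectic.PlanarMonodromy
import Literature.Geometry.Symplectic.GirouxContactPathNbhd
import HarnessLib

/-!
# A planar monodromy chart pins the tubes to the binding components: `K.k = n + 1`, the cores
# are pairwise disjoint, and every open book with the same binding has at least `n + 1` tubes

Topic `Literature/Geometry/Symplectic`; sibling of `PlanarMonodromy.lean` (D-a of the vocabulary
programme of the crux `ConvexBisection.PlanarAcyclicBisectionRigidity`) and of
`PlanarMonodromyProofs.lean`.  Consumers of the cite fact
`Literature.Geometry.Symplectic.supportedPlanarMonodromy` (F-a) receive a RE-TUBED open book `K'`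
with `K'.binding = K.binding` and `K'.HasPlanarMonodromy n φ`; the number `n` of holes of the model
page is what every later step is indexed by (Wendl's factorisation lives in `Mod(P_n, ∂)`; for
Oba 2016, Thm. 1.1 (Geom. Dedicata 183), the hypothesis "page `Σ_{0,4}`" is `n = 3`).  This file proves the elementary
topology that recovers `n` from the tube count of the ORIGINAL open book — the tree's `OpenBook`
(`PlanarContactBoundary.lean`) allows several tubes around one binding component, so only an
inequality holds:

* `OpenBook.subset_range_core_of_isPreconnected` — a preconnected subset of the binding lies in ONE
  binding component (two components coincide or are disjoint, `OpenBook.range_core_eq_or_disjoint`,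
  and they are closed);
* `OpenBook.k_le_of_binding_eq_of_pairwise_disjoint` — **if `K'` and `K` have the same binding and
  the cores of `K'` are pairwise disjoint, then `K'.k ≤ K.k`** (each core of `K'` lies in a core of
  `K`, injectively);
* `IsMonodromyChart.pairwise_disjoint_range_core` — **an open book admitting a monodromy chart
  (`IsMonodromyChart K n f r σ Φ`, `r > 0`, `f` fixing the boundary circles of the page pointwise)
  has pairwise disjoint cores**: two tubes about one binding component whose `r`-tori both lie in
  `range Φ = (thinTubes K r)ᶜ` have the same open `r`-tube (a connectedness argument), hence the
  same `r`-torus, and then `Φ` identifies boundary points of two distinct boundary circles of the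
  page slice — contradicting its injectivity (`PlanarPage.bdryPt_injective_left`: distinct boundary
  circles of `P_n` are disjoint);
* `OpenBook.HasPlanarMonodromy.k_eq` (`K.k = n + 1`, the matching `σ` is a bijection),
  `OpenBook.HasPlanarMonodromy.pairwise_disjoint_range_core`, and the consumer form
  `OpenBook.HasPlanarMonodromy.succ_le_k_of_binding_eq`: **`K'.HasPlanarMonodromy n φ` and
  `K'.binding = K.binding` give `n + 1 ≤ K.k`**.

Everything is PROVED (no named fact); only Mathlib point-set topology and the tree's `OpenBook` /
`PlanarPage` / `MappingTorus` interfaces are used.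

## References

* J. B. Etnyre, *Lectures on open book decompositions and contact structures*, Clay Math. Proc. 5
  (2006) (arXiv:math/0409402), §2 (Def. 2.1: the binding components and their normal form; an open
  book off a neighbourhood of the binding is the mapping torus of the monodromy). [Etnyre2006]
* T. Oba, *Stein fillings of homology 3-spheres …*, Geom. Dedicata 183 (2016), 69–80
  (arXiv:1407.5257), Thm. 1.1. [Oba2016]
-/

noncomputable section

open scoped Manifold ContDiff Topology Real
open Set Function Filter
open Literature.Topology.FourManifolds (PlanarPage MappingTorus)
open Literature.Topology.FourManifolds.PlanarWords (ArcData)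

/-! ### Distinct boundary circles of the model page are disjoint -/

namespace Literature.Topology.FourManifolds.PlanarPage

open Complex

variable {n : ℕ}

/-- `2ρ < 2/(n+1)`: two hole radii do not reach from one hole centre to the next. [folklore] -/
theorem two_mul_holeRadius_lt (n : ℕ) : 2 * holeRadius n < 2 / (n + 1) := by
  unfold holeRadius
  have hn : (0 : ℝ) < n + 1 := by positivity
  rw [mul_one_div]
  exact div_lt_div_of_pos_left two_pos hn (by nlinarith)

/-- `ρ < 2/(n+1)`. [folklore] -/
theorem holeRadius_lt_two_div (n : ℕ) : holeRadius n < 2 / (n + 1) := by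
  have := two_mul_holeRadius_lt n
  have h0 := holeRadius_pos n
  linarith

/-- Points of the outer circle have modulus `1`. [folklore] -/
theorem norm_coe_outerPt (s : ℝ) : ‖((outerPt n s : PlanarPage n) : ℂ)‖ = 1 := by
  show ‖I * exp (2 * π * s * I)‖ = 1
  rw [norm_mul, norm_I, one_mul,
    show (2 * π * s * I : ℂ) = ((2 * π * s : ℝ) : ℂ) * I by push_cast; ring, norm_exp_ofReal_mul_I]

/-- Points of the boundary of hole `j` are at distance `ρ` from its centre. [folklore] -/
theorem norm_coe_innerPt_sub (j : Fin n) (s : ℝ) :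
    ‖((innerPt n j s : PlanarPage n) : ℂ) - holeCentre n j‖ = holeRadius n := by
  show ‖(holeCentre n j : ℂ) + holeRadius n * (I * exp (-(2 * π * s) * I)) - holeCentre n j‖ = _
  rw [add_sub_cancel_left, norm_mul, norm_mul, norm_I, one_mul, norm_real, Real.norm_eq_abs,
    abs_of_pos (holeRadius_pos n),
    show (-(2 * π * s) * I : ℂ) = ((-(2 * π * s) : ℝ) : ℂ) * I by push_cast; ring,
    norm_exp_ofReal_mul_I, mul_one]

/-- Points of the boundary of a hole have modulus `< 1` (the holes stay inside the open unit
disc). [folklore] -/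
theorem norm_coe_innerPt_lt_one (j : Fin n) (s : ℝ) :
    ‖((innerPt n j s : PlanarPage n) : ℂ)‖ < 1 := by
  have h1 := norm_coe_innerPt_sub (n := n) j s
  have h2 := abs_holeCentre_le (n := n) j
  have h3 := holeRadius_lt_two_div n
  have h4 : ‖((innerPt n j s : PlanarPage n) : ℂ)‖ ≤
      ‖((innerPt n j s : PlanarPage n) : ℂ) - holeCentre n j‖ + ‖(holeCentre n j : ℂ)‖ :=
    norm_le_norm_sub_add _ _
  rw [h1, norm_real, Real.norm_eq_abs] at h4
  linarith

/-- Boundary circles of distinct holes are disjoint. [folklore] -/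
theorem innerPt_ne_innerPt {j k : Fin n} (h : j ≠ k) (s t : ℝ) : innerPt n j s ≠ innerPt n k t := by
  intro heq
  have hz : ((innerPt n j s : PlanarPage n) : ℂ) = ((innerPt n k t : PlanarPage n) : ℂ) :=
    congrArg Subtype.val heq
  have h1 := norm_coe_innerPt_sub (n := n) j s
  have h2 := norm_coe_innerPt_sub (n := n) k t
  rw [← hz] at h2
  have hsep := two_div_le_abs_holeCentre_sub h
  have htri : ‖(holeCentre n j : ℂ) - holeCentre n k‖ ≤
      ‖((innerPt n j s : PlanarPage n) : ℂ) - holeCentre n j‖ +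
        ‖((innerPt n j s : PlanarPage n) : ℂ) - holeCentre n k‖ := by
    have := norm_sub_le (((innerPt n j s : PlanarPage n) : ℂ) - holeCentre n k)
      (((innerPt n j s : PlanarPage n) : ℂ) - holeCentre n j)
    rw [sub_sub_sub_cancel_left] at this
    rw [add_comm]; exact this
  rw [h1, h2, ← ofReal_sub, norm_real, Real.norm_eq_abs] at htri
  have := two_mul_holeRadius_lt n
  linarith

/-- **Distinct boundary circles of the model page are disjoint**: `bdryPt n l s = bdryPt n l' s'`
forces `l = l'` (the outer circle has modulus `1`, the hole circles modulus `< 1`, and two hole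
circles are `≥ 2/(n+1) > 2ρ` apart). [folklore] -/
theorem bdryPt_injective_left {l l' : Option (Fin n)} {s s' : ℝ}
    (h : bdryPt n l s = bdryPt n l' s') : l = l' := by
  cases l with
  | none =>
    cases l' with
    | none => rfl
    | some k =>
      exfalso
      have h1 := norm_coe_outerPt (n := n) s
      have h2 := norm_coe_innerPt_lt_one (n := n) k s'
      have : ((outerPt n s : PlanarPage n) : ℂ) = ((innerPt n k s' : PlanarPage n) : ℂ) :=
        congrArg Subtype.val h
      rw [this] at h1
      linarith
  | some j =>
    cases l' with
    | none =>
      exfalso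
      have h1 := norm_coe_outerPt (n := n) s'
      have h2 := norm_coe_innerPt_lt_one (n := n) j s
      have : ((innerPt n j s : PlanarPage n) : ℂ) = ((outerPt n s' : PlanarPage n) : ℂ) :=
        congrArg Subtype.val h
      rw [← this] at h1
      linarith
    | some k =>
      by_contra hjk
      have hjk' : j ≠ k := fun e => hjk (by rw [e])
      exact innerPt_ne_innerPt hjk' s s' h

end Literature.Topology.FourManifolds.PlanarPage

namespace Literature.Geometry.Symplectic

universe u

variable {N : Type u} [TopologicalSpace N] [ChartedSpace (EuclideanSpace ℝ (Fin 3)) N] [IsManifold (𝓡 3) ∞ N]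

/-! ### The circle parametrisation is onto; polar form of plane vectors -/

/-- Every point of the unit circle is `circlePoint s` for some `s` (the `2π`-periodic
parametrisation of `Knots.lean` is onto, `Literature.Topology.FourManifolds.circlePoint_surjective`).
[folklore] -/
theorem exists_circlePoint_eq (x : (Metric.sphere (0 : EuclideanSpace ℝ (Fin 2)) 1)) : ∃ s : ℝ, circlePoint s = x := by
  obtain ⟨θ, hθ⟩ := Literature.Topology.FourManifolds.circlePoint_surjective x
  refine ⟨θ / (2 * Real.pi), Subtype.ext ?_⟩
  have h2 : 2 * Real.pi * (θ / (2 * Real.pi)) = θ := by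
    field_simp
  rw [← hθ]
  ext i
  fin_cases i
  · show Real.cos (2 * Real.pi * (θ / (2 * Real.pi))) =
      (Literature.Topology.FourManifolds.circlePoint θ : EuclideanSpace ℝ (Fin 2)) 0
    rw [h2, Literature.Topology.FourManifolds.circlePoint_apply_zero]
  · show Real.sin (2 * Real.pi * (θ / (2 * Real.pi))) =
      (Literature.Topology.FourManifolds.circlePoint θ : EuclideanSpace ℝ (Fin 2)) 1
    rw [h2, Literature.Topology.FourManifolds.circlePoint_apply_one]

/-- Polar form: a plane vector of norm `r > 0` is `r • anglePt t` for some `t`. [folklore] -/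
theorem exists_eq_smul_anglePt {r : ℝ} (hr : 0 < r) {w : EuclideanSpace ℝ (Fin 2)} (hw : ‖w‖ = r) :
    ∃ t : ℝ, w = r • anglePt t := by
  have hw1 : ‖r⁻¹ • w‖ = 1 := by
    rw [norm_smul, norm_inv, Real.norm_eq_abs, abs_of_pos hr, hw, inv_mul_cancel₀ hr.ne']
  have hmem : r⁻¹ • w ∈ ((Metric.sphere (0 : EuclideanSpace ℝ (Fin 2)) 1)) := by simpa using hw1
  obtain ⟨t, ht⟩ := exists_circlePoint_eq ⟨r⁻¹ • w, hmem⟩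
  refine ⟨t, ?_⟩
  have hval : (anglePt t : EuclideanSpace ℝ (Fin 2)) = r⁻¹ • w := congrArg Subtype.val ht
  rw [hval, smul_inv_smul₀ hr.ne']

namespace OpenBook

/-! ### Binding components: a preconnected subset of the binding lies in one of them -/

/-- The binding is the union of the cores of the tubes. [folklore] -/
theorem binding_eq_iUnion_range_core (K : OpenBook N) : K.binding = ⋃ i, range (K.core i) := by
  ext y
  rw [K.mem_binding_iff, mem_iUnion]
  constructor
  · rintro ⟨i, x, h⟩; exact ⟨i, x, h⟩
  · rintro ⟨i, x, h⟩; exact ⟨i, x, h⟩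

/-- The cores are compact. [folklore] -/
theorem isCompact_range_core (K : OpenBook N) (i : Fin K.k) : IsCompact (range (K.core i)) :=
  isCompact_range (K.continuous_core i)

/-- The cores are closed (Hausdorff ambient manifold). [folklore] -/
theorem isClosed_range_core [T2Space N] (K : OpenBook N) (i : Fin K.k) :
    IsClosed (range (K.core i)) :=
  (K.isCompact_range_core i).isClosed

/-- The cores are preconnected (images of the circle). [folklore] -/
theorem isPreconnected_range_core (K : OpenBook N) (i : Fin K.k) :
    IsPreconnected (range (K.core i)) := by
  have h2 : 1 < Module.rank ℝ (EuclideanSpace ℝ (Fin 2)) := by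
    rw [← Module.finrank_eq_rank, finrank_euclideanSpace_fin]; norm_num
  haveI : PreconnectedSpace ((Metric.sphere (0 : EuclideanSpace ℝ (Fin 2)) 1)) :=
    isPreconnected_iff_preconnectedSpace.1 (isPreconnected_sphere h2 0 1)
  exact isPreconnected_range (K.continuous_core i)

/-- **A preconnected subset of the binding lies in one binding component**: the components
`range (core i)` are closed and pairwise equal or disjoint (`range_core_eq_or_disjoint`), so a
preconnected `C ⊆ B` through the point `y ∈ range (core j)` cannot leave `range (core j)`.
[cite: Etnyre2006, Def. 2.1] -/
theorem subset_range_core_of_isPreconnected [T2Space N] (K : OpenBook N) {C : Set N}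
    (hC : IsPreconnected C) (hCB : C ⊆ K.binding) {j : Fin K.k} {y : N} (hy : y ∈ C)
    (hyj : y ∈ range (K.core j)) : C ⊆ range (K.core j) := by
  classical
  set v : Set N := ⋃ i ∈ {i : Fin K.k | Disjoint (range (K.core i)) (range (K.core j))},
    range (K.core i) with hv
  have hvc : IsClosed v :=
    (toFinite _).isClosed_biUnion fun i _ => K.isClosed_range_core i
  have hsub : C ⊆ range (K.core j) ∪ v := by
    intro z hz
    obtain ⟨i, x', rfl⟩ := (K.mem_binding_iff z).1 (hCB hz)
    rcases K.range_core_eq_or_disjoint i j with h | h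
    · exact Or.inl (h ▸ ⟨x', rfl⟩)
    · exact Or.inr (mem_biUnion (show i ∈ {i : Fin K.k | _} from h) ⟨x', rfl⟩)
  have hdisj : range (K.core j) ∩ v = ∅ := by
    refine eq_empty_iff_forall_notMem.2 fun z hz => ?_
    obtain ⟨i, hi, hzi⟩ := mem_iUnion₂.1 hz.2
    exact Set.disjoint_left.1 hi hzi hz.1
  rcases (isPreconnected_iff_subset_of_disjoint_closed.1 hC) _ _ (K.isClosed_range_core j) hvc hsub
      (by rw [hdisj, inter_empty]) with h | h
  · exact h
  · exfalso
    obtain ⟨i, hi, hyi⟩ := mem_iUnion₂.1 (h hy)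
    exact Set.disjoint_left.1 hi hyi hyj

/-- A preconnected nonempty subset of the binding lies in SOME binding component. [folklore] -/
theorem exists_subset_range_core_of_isPreconnected [T2Space N] (K : OpenBook N) {C : Set N}
    (hC : IsPreconnected C) (hCB : C ⊆ K.binding) (hne : C.Nonempty) :
    ∃ j, C ⊆ range (K.core j) := by
  obtain ⟨y, hy⟩ := hne
  obtain ⟨j, x, hx⟩ := (K.mem_binding_iff y).1 (hCB hy)
  exact ⟨j, K.subset_range_core_of_isPreconnected hC hCB hy ⟨x, hx⟩⟩

/-- **Same binding, pairwise disjoint cores ⇒ no more tubes**: if `K'.binding = K.binding` and the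
cores of `K'` are pairwise disjoint, then `K'.k ≤ K.k`.  Each core of `K'` (connected, in the common
binding) lies in a core of `K`; this assignment is injective, because a core of `K` lies in turn in
ONE core of `K'`, which then meets — hence equals the index of — every core of `K'` inside it.
[cite: Etnyre2006, Def. 2.1] -/
theorem k_le_of_binding_eq_of_pairwise_disjoint [T2Space N] {K K' : OpenBook N}
    (hB : K'.binding = K.binding)
    (hdisj : Pairwise fun a b => Disjoint (range (K'.core a)) (range (K'.core b))) :
    K'.k ≤ K.k := by
  have hsub' : ∀ a, range (K'.core a) ⊆ K.binding := fun a => by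
    rw [← hB, K'.binding_eq_iUnion_range_core]
    exact subset_iUnion (fun i => range (K'.core i)) a
  have hsub : ∀ j, range (K.core j) ⊆ K'.binding := fun j => by
    rw [hB, K.binding_eq_iUnion_range_core]
    exact subset_iUnion (fun i => range (K.core i)) j
  have h1 : ∀ a, ∃ j, range (K'.core a) ⊆ range (K.core j) := fun a =>
    K.exists_subset_range_core_of_isPreconnected (K'.isPreconnected_range_core a) (hsub' a)
      ⟨_, circlePoint 0, rfl⟩
  choose j hj using h1
  have hinj : Injective j := by
    intro a a' haa'
    obtain ⟨c, hc⟩ := K'.exists_subset_range_core_of_isPreconnected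
      (K.isPreconnected_range_core (j a)) (hsub (j a)) ⟨_, circlePoint 0, rfl⟩
    have key : ∀ b, range (K'.core b) ⊆ range (K.core (j a)) → b = c := by
      intro b hb
      by_contra hbc
      exact Set.disjoint_left.1 (hdisj hbc) ⟨circlePoint 0, rfl⟩
        (hc (hb ⟨circlePoint 0, rfl⟩))
    have ea : a = c := key a (hj a)
    have ea' : a' = c := key a' (haa' ▸ hj a')
    exact ea.trans ea'.symm
  simpa using Fintype.card_le_of_injective j hinj

/-- Two open books with the same binding, both with pairwise disjoint cores, have the same number of
tubes (the number of binding components). [cite: Etnyre2006, Def. 2.1] -/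
theorem k_eq_of_binding_eq_of_pairwise_disjoint [T2Space N] {K K' : OpenBook N}
    (hB : K'.binding = K.binding)
    (hdisj : Pairwise fun a b => Disjoint (range (K.core a)) (range (K.core b)))
    (hdisj' : Pairwise fun a b => Disjoint (range (K'.core a)) (range (K'.core b))) :
    K'.k = K.k :=
  le_antisymm (k_le_of_binding_eq_of_pairwise_disjoint hB hdisj')
    (k_le_of_binding_eq_of_pairwise_disjoint hB.symm hdisj)

/-! ### Thin tubes and their boundary tori -/

/-- The thin tubes of radius `r` are the union of the open `r`-tubes `tubeSet i r`. [folklore] -/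
theorem thinTubes_eq_iUnion_tubeSet (K : OpenBook N) (r : ℝ) :
    thinTubes K r = ⋃ i, K.tubeSet i r := rfl

/-- The `r`-torus `tube i (𝕊¹ × {‖w‖ = r})` about the `i`-th binding component. [folklore] -/
theorem tube_mem_image_sphere_iff (K : OpenBook N) (i : Fin K.k) (x : (Metric.sphere (0 : EuclideanSpace ℝ (Fin 2)) 1)) (w : EuclideanSpace ℝ (Fin 2)) (r : ℝ) :
    K.tube i (x, w) ∈ K.tube i '' (univ ×ˢ Metric.sphere (0 : EuclideanSpace ℝ (Fin 2)) r) ↔ ‖w‖ = r := by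
  constructor
  · rintro ⟨⟨x', w'⟩, ⟨-, hw'⟩, h⟩
    obtain ⟨-, rfl⟩ := Prod.ext_iff.1 (K.injective_tube i h)
    simpa using hw'
  · intro h
    exact ⟨(x, w), ⟨mem_univ _, by simpa using h⟩, rfl⟩

/-- The closed `r`-tube is the open `r`-tube plus the `r`-torus. [folklore] -/
theorem tubeSetC_eq_union (K : OpenBook N) (i : Fin K.k) (r : ℝ) :
    K.tubeSetC i r = K.tubeSet i r ∪ K.tube i '' (univ ×ˢ Metric.sphere (0 : EuclideanSpace ℝ (Fin 2)) r) := by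
  rw [tubeSetC, tubeSet, ← image_union, ← prod_union, Metric.ball_union_sphere]

/-- The open `r`-tube misses the `r`-torus. [folklore] -/
theorem disjoint_tubeSet_image_sphere (K : OpenBook N) (i : Fin K.k) (r : ℝ) :
    Disjoint (K.tubeSet i r) (K.tube i '' (univ ×ˢ Metric.sphere (0 : EuclideanSpace ℝ (Fin 2)) r)) := by
  refine Set.disjoint_left.2 ?_
  rintro _ ⟨⟨x, w⟩, ⟨-, hw⟩, rfl⟩ hmem
  rw [K.tube_mem_image_sphere_iff] at hmem
  have hw' : ‖w‖ < r := by simpa using hw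
  exact hw'.ne hmem

/-- For `r > 0` the closed `r`-tube is the closure of the open one (the tube map is an embedding of
`𝕊¹ × ℝ²` with compact, hence closed, image of `𝕊¹ × {‖w‖ ≤ r}`). [folklore] -/
theorem closure_tubeSet [T2Space N] (K : OpenBook N) (i : Fin K.k) {r : ℝ} (hr : 0 < r) :
    closure (K.tubeSet i r) = K.tubeSetC i r := by
  apply Subset.antisymm
  · exact closure_minimal (K.tubeSet_subset_tubeSetC i r) (K.isClosed_tubeSetC i r)
  · have h1 : K.tubeSetC i r = K.tube i '' closure (univ ×ˢ Metric.ball (0 : EuclideanSpace ℝ (Fin 2)) r) := by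
      rw [closure_prod_eq, closure_univ, closure_ball (0 : EuclideanSpace ℝ (Fin 2)) hr.ne']; rfl
    rw [h1]
    exact image_closure_subset_closure_image (K.continuous_tube i)

/-- The `r`-torus is the closed `r`-tube minus the open one. [folklore] -/
theorem image_sphere_eq_tubeSetC_diff (K : OpenBook N) (i : Fin K.k) (r : ℝ) :
    K.tube i '' (univ ×ˢ Metric.sphere (0 : EuclideanSpace ℝ (Fin 2)) r) = K.tubeSetC i r \ K.tubeSet i r := by
  rw [K.tubeSetC_eq_union, union_sdiff_left, eq_comm, sdiff_eq_left]
  exact (K.disjoint_tubeSet_image_sphere i r).symm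

/-- Open tubes are preconnected (images of `𝕊¹ × {‖w‖ < r}`). [folklore] -/
theorem isPreconnected_tubeSet (K : OpenBook N) (i : Fin K.k) (r : ℝ) :
    IsPreconnected (K.tubeSet i r) := by
  have h2 : 1 < Module.rank ℝ (EuclideanSpace ℝ (Fin 2)) := by
    rw [← Module.finrank_eq_rank, finrank_euclideanSpace_fin]; norm_num
  haveI : PreconnectedSpace ((Metric.sphere (0 : EuclideanSpace ℝ (Fin 2)) 1)) :=
    isPreconnected_iff_preconnectedSpace.1 (isPreconnected_sphere h2 0 1)
  exact (isPreconnected_univ.prod (convex_ball (0 : EuclideanSpace ℝ (Fin 2)) r).isPreconnected).image _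
    (K.continuous_tube i).continuousOn

/-- **Two open `r`-tubes about ONE binding component, each missing the other's `r`-torus,
coincide.**  `tubeSet b r` is connected, contains the common core, and misses the torus
`tube a (𝕊¹ × {‖w‖ = r})`, i.e. lies in the disjoint union of the open sets `tubeSet a r` and
`(tubeSetC a r)ᶜ`; meeting the first, it lies in it. [folklore] -/
theorem tubeSet_subset_tubeSet_of_range_core_eq [T2Space N] (K : OpenBook N) {a b : Fin K.k}
    {r : ℝ} (hr : 0 < r) (hcore : range (K.core a) = range (K.core b))
    (hmiss : Disjoint (K.tubeSet b r) (K.tube a '' (univ ×ˢ Metric.sphere (0 : EuclideanSpace ℝ (Fin 2)) r))) :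
    K.tubeSet b r ⊆ K.tubeSet a r := by
  have hu : IsOpen (K.tubeSet a r) := K.isOpen_tubeSet a r
  have hv : IsOpen (K.tubeSetC a r)ᶜ := (K.isClosed_tubeSetC a r).isOpen_compl
  have huv : Disjoint (K.tubeSet a r) (K.tubeSetC a r)ᶜ :=
    disjoint_compl_right.mono_left (K.tubeSet_subset_tubeSetC a r)
  have hsub : K.tubeSet b r ⊆ K.tubeSet a r ∪ (K.tubeSetC a r)ᶜ := by
    intro z hz
    by_cases hzC : z ∈ K.tubeSetC a r
    · rw [K.tubeSetC_eq_union] at hzC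
      rcases hzC with h | h
      · exact Or.inl h
      · exact absurd h (Set.disjoint_left.1 hmiss hz)
    · exact Or.inr hzC
  have hne : (K.tubeSet b r ∩ K.tubeSet a r).Nonempty := by
    refine ⟨K.core a (circlePoint 0), ?_, K.range_core_subset_tubeSet a hr ⟨_, rfl⟩⟩
    have : K.core a (circlePoint 0) ∈ range (K.core b) := hcore ▸ ⟨_, rfl⟩
    exact K.range_core_subset_tubeSet b hr this
  exact (K.isPreconnected_tubeSet b r).subset_left_of_subset_union hu hv huv hsub hne

end OpenBook

/-! ### A monodromy chart forces pairwise disjoint cores -/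

namespace IsMonodromyChart

variable {K : OpenBook N} {n : ℕ} {f : PlanarPage n ≃ₜ PlanarPage n} {r : ℝ}
  {σ : Option (Fin n) ≃ Fin K.k} {Φ : MappingTorus f.symm → N}

/-- Every point of an `r`-torus is a chart image of a boundary point of a page slice: for
`‖w‖ = r > 0`, `tube i (x, w) = Φ [bdryPt (σ⁻¹ i) s, t]` with `x = circlePoint s`,
`w = r · anglePt t`. [cite: Etnyre2006, §2 Lemma 2.3 (arXiv numbering)] -/
theorem exists_eq_apply_mk (h : IsMonodromyChart K n f r σ Φ) (hr : 0 < r) (i : Fin K.k)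
    (x : (Metric.sphere (0 : EuclideanSpace ℝ (Fin 2)) 1)) {w : EuclideanSpace ℝ (Fin 2)} (hw : ‖w‖ = r) :
    ∃ s t : ℝ, K.tube i (x, w) = Φ (MappingTorus.mk f.symm (PlanarPage.bdryPt n (σ.symm i) s) t) := by
  obtain ⟨s, rfl⟩ := exists_circlePoint_eq x
  obtain ⟨t, rfl⟩ := exists_eq_smul_anglePt hr hw
  exact ⟨s, t, by rw [h.boundary, Equiv.apply_symm_apply]⟩

/-- The `r`-tori lie in the range of the chart … [folklore] -/
theorem image_sphere_subset_range (h : IsMonodromyChart K n f r σ Φ) (hr : 0 < r) (i : Fin K.k) :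
    K.tube i '' (univ ×ˢ Metric.sphere (0 : EuclideanSpace ℝ (Fin 2)) r) ⊆ range Φ := by
  rintro _ ⟨⟨x, w⟩, ⟨-, hw⟩, rfl⟩
  have hw' : ‖w‖ = r := by simpa using hw
  obtain ⟨s, t, hst⟩ := h.exists_eq_apply_mk hr i x hw'
  exact ⟨_, hst.symm⟩

/-- … hence miss every open `r`-tube. [folklore] -/
theorem disjoint_tubeSet_image_sphere (h : IsMonodromyChart K n f r σ Φ) (hr : 0 < r)
    (a b : Fin K.k) :
    Disjoint (K.tubeSet b r) (K.tube a '' (univ ×ˢ Metric.sphere (0 : EuclideanSpace ℝ (Fin 2)) r)) := by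
  refine Set.disjoint_left.2 fun z hzb hza => ?_
  have hz : z ∈ range Φ := h.image_sphere_subset_range hr a hza
  rw [h.range_eq] at hz
  exact hz (mem_iUnion.2 ⟨b, hzb⟩)

/-- **An open book with a monodromy chart has pairwise disjoint cores** (for `r > 0` and a
first-return map fixing the boundary circles of the page pointwise).  If two tubes `a ≠ b` had the
same core, their open `r`-tubes would coincide (`tubeSet_subset_tubeSet_of_range_core_eq` twice),
hence so would their `r`-tori (closure minus interior); a point of the common torus is then BOTH
`Φ [bdryPt (σ⁻¹ a) 0, 0]` and `Φ [bdryPt (σ⁻¹ b) s, t]`, and injectivity of `Φ` with the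
mapping-torus identifications (`f` fixes boundary points) puts one point on two distinct boundary
circles of `P_n`. [cite: Etnyre2006, §2 Lemma 2.3 (arXiv numbering)] -/
theorem pairwise_disjoint_range_core [T2Space N] (h : IsMonodromyChart K n f r σ Φ) (hr : 0 < r)
    (hf : ∀ l s, f (PlanarPage.bdryPt n l s) = PlanarPage.bdryPt n l s) :
    Pairwise fun a b => Disjoint (range (K.core a)) (range (K.core b)) := by
  intro a b hab
  by_contra hnd
  have hcore : range (K.core a) = range (K.core b) :=
    (K.range_core_eq_or_disjoint a b).resolve_right hnd
  -- the two open `r`-tubes coincide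
  have hTeq : K.tubeSet a r = K.tubeSet b r :=
    Subset.antisymm
      (K.tubeSet_subset_tubeSet_of_range_core_eq hr hcore.symm (h.disjoint_tubeSet_image_sphere hr b a))
      (K.tubeSet_subset_tubeSet_of_range_core_eq hr hcore (h.disjoint_tubeSet_image_sphere hr a b))
  -- hence so do the two `r`-tori
  have hTorus : K.tube a '' (univ ×ˢ Metric.sphere (0 : EuclideanSpace ℝ (Fin 2)) r) =
      K.tube b '' (univ ×ˢ Metric.sphere (0 : EuclideanSpace ℝ (Fin 2)) r) := by
    rw [K.image_sphere_eq_tubeSetC_diff, K.image_sphere_eq_tubeSetC_diff,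
      ← K.closure_tubeSet a hr, ← K.closure_tubeSet b hr, hTeq]
  -- a point of the common torus, read through both tubes
  set y : N := K.tube a (circlePoint 0, r • anglePt 0) with hy
  have hnorm : ‖r • anglePt 0‖ = r := by
    rw [norm_smul, Real.norm_eq_abs, abs_of_pos hr, norm_anglePt, mul_one]
  have hya : y = Φ (MappingTorus.mk f.symm (PlanarPage.bdryPt n (σ.symm a) 0) 0) := by
    rw [hy, h.boundary, Equiv.apply_symm_apply]
  have hyTa : y ∈ K.tube a '' (univ ×ˢ Metric.sphere (0 : EuclideanSpace ℝ (Fin 2)) r) :=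
    (K.tube_mem_image_sphere_iff a (circlePoint 0) (r • anglePt 0) r).2 hnorm
  rw [hTorus] at hyTa
  obtain ⟨⟨x', w'⟩, ⟨-, hw'⟩, hyb⟩ := hyTa
  have hw'' : ‖w'‖ = r := by simpa using hw'
  obtain ⟨s, t, hst⟩ := h.exists_eq_apply_mk hr b x' hw''
  have hmk : MappingTorus.mk f.symm (PlanarPage.bdryPt n (σ.symm a) 0) 0 =
      MappingTorus.mk f.symm (PlanarPage.bdryPt n (σ.symm b) s) t :=
    h.injective (by rw [← hya, ← hyb, hst])
  obtain ⟨k, -, hk⟩ := (MappingTorus.mk_eq_mk_iff f.symm).1 hmk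
  have hfix : f.symm (PlanarPage.bdryPt n (σ.symm a) 0) = PlanarPage.bdryPt n (σ.symm a) 0 := by
    rw [Homeomorph.symm_apply_eq]; exact (hf _ _).symm
  rw [Equiv.Perm.zpow_apply_eq_self_of_apply_eq_self hfix] at hk
  have hl : σ.symm b = σ.symm a := PlanarPage.bdryPt_injective_left hk
  exact hab (σ.symm.injective hl).symm

end IsMonodromyChart

/-! ### Consequences for `HasPlanarMonodromy` -/

namespace OpenBook.HasPlanarMonodromy

variable {K : OpenBook N} {n : ℕ} {φ : ArcData n}

/-- **An open book with planar page `P_n` has exactly `n + 1` tubes** (the matching `σ` of the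
`n + 1` boundary circles of the page with the tubes is a bijection).
[cite: Etnyre2006, §2 Lemma 2.3 (arXiv numbering)] -/
theorem k_eq (h : K.HasPlanarMonodromy n φ) : K.k = n + 1 := by
  obtain ⟨-, f, -, r, σ, Φ, -, -⟩ := h
  have := Fintype.card_congr σ
  simpa [Fintype.card_option] using this.symm

/-- The first-return map of a planar monodromy with trivial hole permutation fixes every boundary
point of the page. [folklore] -/
theorem apply_bdryPt {f : PlanarPage n ≃ₜ PlanarPage n} (hφ : φ.perm = 1)
    (hf : PlanarPage.IsRealisedBy n φ f) (l : Option (Fin n)) (s : ℝ) :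
    f (PlanarPage.bdryPt n l s) = PlanarPage.bdryPt n l s := by
  cases l with
  | none => exact hf.outer s
  | some j =>
    show f (PlanarPage.innerPt n j s) = PlanarPage.innerPt n j s
    rw [hf.inner, hφ, Equiv.Perm.one_apply]

/-- **An open book with a planar monodromy has pairwise disjoint cores.**
[cite: Etnyre2006, §2 Lemma 2.3 (arXiv numbering)] -/
theorem pairwise_disjoint_range_core [T2Space N] (h : K.HasPlanarMonodromy n φ) :
    Pairwise fun a b => Disjoint (range (K.core a)) (range (K.core b)) := by
  obtain ⟨hperm, f, hf, r, σ, Φ, hr, hchart⟩ := h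
  exact hchart.pairwise_disjoint_range_core hr (apply_bdryPt hperm hf)

/-- **Consumer form**: if `K'` has planar page `P_n` and the same binding as `K`, then
`n + 1 ≤ K.k` — the number of holes of the page is less than the number of tubes of ANY open book
with that binding (with equality when the tubes of `K` have pairwise distinct cores).  For the
re-tubed book `K'` of `supportedPlanarMonodromy` this recovers `n` from the original data; e.g.
four tubes (Oba 2016, Thm. 1.1: page `Σ_{0,4}`) give `n ≤ 3`.
[cite: Etnyre2006, §2 Lemma 2.3 (arXiv numbering)] [cite: Oba2016, Thm. 1.1] -/
theorem succ_le_k_of_binding_eq [T2Space N] {K' : OpenBook N} (h : K'.HasPlanarMonodromy n φ)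
    (hB : K'.binding = K.binding) : n + 1 ≤ K.k := by
  rw [← h.k_eq]
  exact OpenBook.k_le_of_binding_eq_of_pairwise_disjoint hB h.pairwise_disjoint_range_core

end OpenBook.HasPlanarMonodromy

end Literature.Geometry.Symplectic

end
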